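import Summits.HubbardSuperconductivity.HubbardSuperconductivity.Theorems.WidthHaldaneKineticFloor

/-!
# The profile gauge: relocating the seam flux to an arbitrary column profile (identities)

Crux `WidthHaldaneBridge` (stmt-HubbardSuperconductivity-16311): the stiffness clause of its
hypothesis `UniformThermo` is an inequality between sector MINIMA of the seam-twisted and the
untwisted tube. Crux idea `twist-transfer-floors` (2026-08-17 round, first lemma `LeggettFloor`)
transfers it onto every `θ = 0` ground state `ψ` by relocating the seam flux to an ARBITRARY column
profile: conjugating `tubeH0 + tubeTwist θ` by the site phases `g_z = e^{iΦ(z₁)}` (`Φ : ℤ/L → ℝ` any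
column potential) puts the Peierls phase `e^{iφ_a}`, `φ_a = Φ(a) - Φ(a-1) + θ·[a = 0]`, on the `M`
bonds of the cut between the columns `a - 1` and `a` (so `Σ_a φ_a = θ`: the flux is conserved), and
pricing `ψ` in the two orientations `(Φ, θ)`, `(-Φ, -θ)` (the bond currents cancel, `E(-θ) = E(θ)`)
gives, for every normalised `(N, S^z = 0)` sector ground state `ψ` of `tubeH0` (`L ≥ 3`):

  **`E(θ) - E(0) ≤ Σ_a (1 - cos φ_a) · k_a(ψ)`**,
  `k_a(ψ) = Σ_{b,σ} Re⟨ψ, (c†_{(a,b)σ} c_{(a-1,b)σ} + c†_{(a-1,b)σ} c_{(a,b)σ}) ψ⟩`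

(Leggett 1970; Paramekanti–Trivedi–Randeria 1998 §IV, eq. (var-bd)). The uniform profile
`Φ(a) = θ·a/L` is the Bloch/kinetic-floor case of `Theorems/WidthHaldaneKineticFloor.lean`; the
optimal profile `φ_a ∝ 1/k_a` gives Leggett's harmonic-mean floor (`Theorems/WidthHaldaneLeggettFloor`).

This file PROVES the gauge identities (no definition, no named fact):

* `profileGauge_mul_conj` — `g_x conj(g_y) = e^{i(Φ(x₁) - Φ(y₁))}`;
* `profile_pointwise` — after conjugation the total coefficient of `c†_{xσ}c_{yσ}` (graph term plus the
  two seam terms) is `-e^{iφ(x₁)}` if `x = y + e₁`, `-e^{-iφ(y₁)}` if `y = x + e₁`, `-1` transversally,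
  `0` otherwise (`L ≥ 3`);
* `expect_profileGauged_tubeH`, `re_expect_profileGauged_tubeH` — the conjugated twisted tube in
  expectation;
* the `±` trick, the column bookkeeping and the displayed bound itself are in the companion file
  `Theorems/WidthHaldaneLeggettBound.lean` (`tubeEnergy_sub_le_profile`, `leggettVariationalBound`).

References: A. J. Leggett, PRL 25 (1970) 1543; A. Paramekanti, N. Trivedi, M. Randeria, PRB 57
(1998) 11639, §IV; H. Watanabe, J. Stat. Phys. 177 (2019) 717, §2.2; T. Koma, H. Tasaki, PRL 68
(1992) 3248, eqs. (7)–(8) (site-phase gauge).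
-/

noncomputable section

namespace Summit.HubbardSuperconductivity.HubbardSuperconductivity.Theorems.WidthHaldane

set_option linter.dupNamespace false -- summit = problem name (single-conjunct summit), D-0017

open scoped BigOperators Classical Matrix ComplexConjugate
open Matrix Literature.MathematicalPhysics.QuantumLattice
open Summit.HubbardSuperconductivity.HubbardSuperconductivity.Theorems.DeformationLadder
  (expect_phaseGauge_conj_hamiltonian expect_hamiltonian_eq)

section Profile

variable (L M : ℕ) [NeZero L] [NeZero M] (Λ : Type) [LinearOrder Λ] [Fintype Λ]
  (e : Λ ≃ ZMod L × ZMod M)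

omit [NeZero L] [NeZero M] [LinearOrder Λ] [Fintype Λ] in
/-- The product of profile-gauge phases as one exponential: `g_x conj(g_y) = e^{i(Φ(x₁) - Φ(y₁))}` for
`g_z = e^{iΦ(z₁)}`. [folklore] -/
theorem profileGauge_mul_conj (Φ : ZMod L → ℝ) (x y : Λ) :
    (Circle.exp (Φ (e x).1) : ℂ) * conj (Circle.exp (Φ (e y).1) : ℂ) =
      Complex.exp (((Φ (e x).1 - Φ (e y).1 : ℝ) : ℂ) * Complex.I) := by
  rw [Circle.coe_exp, Circle.coe_exp, ← Complex.exp_conj, map_mul, Complex.conj_ofReal, Complex.conj_I,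
    ← Complex.exp_add]
  congr 1
  push_cast
  ring

omit [NeZero L] [NeZero M] [Fintype Λ] in
/-- **The pointwise profile-gauge identity** (`L ≥ 3`). After conjugating the seam-twisted tube by
`g_z = e^{iΦ(z₁)}`, the total coefficient of `c†_{xσ} c_{yσ}` — graph term plus the two seam terms —
is `-e^{iφ(x₁)}` if `x = y + e₁`, `-e^{-iφ(y₁)}` if `y = x + e₁` (`φ(a) = Φ(a) - Φ(a-1) + θ·[a = 0]`),
`-1` on the transverse bonds and `0` otherwise: the seam flux may be distributed arbitrarily over the
cuts. [cite: KomaTasakiPRL1992, eqs. (7)–(8)] -/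
theorem profile_pointwise (hL : 3 ≤ L) (Φ : ZMod L → ℝ) (θ : ℝ) (x y : Λ) :
    -(if (tubeGraph e).Adj x y then
        (Circle.exp (Φ (e x).1) : ℂ) * conj (Circle.exp (Φ (e y).1) : ℂ) else 0) +
      (if (e x).1 = 0 ∧ y = e.symm (-1, (e x).2) then (1 - Complex.exp (Complex.I * θ)) *
        ((Circle.exp (Φ (e x).1) : ℂ) * conj (Circle.exp (Φ (e y).1) : ℂ)) else 0) +
      (if (e y).1 = 0 ∧ x = e.symm (-1, (e y).2) then (1 - Complex.exp (-(Complex.I * θ))) *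
        ((Circle.exp (Φ (e x).1) : ℂ) * conj (Circle.exp (Φ (e y).1) : ℂ)) else 0) =
    -(if (tubeGraph e).Adj x y then
        (if (e x).1 = (e y).1 + 1 ∧ (e x).2 = (e y).2 then
            Complex.exp (((Φ (e x).1 - Φ ((e x).1 - 1) + if (e x).1 = 0 then θ else 0 : ℝ) : ℂ) * Complex.I)
          else if (e y).1 = (e x).1 + 1 ∧ (e x).2 = (e y).2 then
            Complex.exp (-((((Φ (e y).1 - Φ ((e y).1 - 1) + if (e y).1 = 0 then θ else 0 : ℝ) : ℂ)) * Complex.I))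
          else 1)
        else 0) := by
  haveI : Fact (1 < L) := ⟨by omega⟩
  rw [profileGauge_mul_conj]
  have hfac : ∀ E W : ℂ, -E + (1 - W) * E = -(W * E) := fun E W => by ring
  -- coordinates
  obtain ⟨⟨a, b⟩, rfl⟩ := e.symm.surjective x
  obtain ⟨⟨a', b'⟩, rfl⟩ := e.symm.surjective y
  simp only [Equiv.apply_symm_apply, EmbeddingLike.apply_eq_iff_eq, SimpleGraph.fromRel_adj, tubeGraph,
    ne_eq, Prod.mk.injEq]
  by_cases h1 : a = a' + 1 ∧ b = b'
  · -- `x = y + e₁`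
    obtain ⟨ha, hb⟩ := h1
    have hadj : (¬(a = a' ∧ b = b') ∧ ((a' = a + 1 ∧ b' = b ∨ a' = a ∧ b' = b + 1) ∨
        (a = a' + 1 ∧ b = b' ∨ a = a' ∧ b = b' + 1))) := by
      refine ⟨fun h => ?_, Or.inr (Or.inl ⟨ha, hb⟩)⟩
      have h0 : (1 : ZMod L) = 0 := by linear_combination ha.symm.trans h.1
      exact one_ne_zero h0
    rw [if_pos hadj, if_pos hadj, if_pos (show a = a' + 1 ∧ b = b' from ⟨ha, hb⟩)]
    have ha' : a' = a - 1 := by rw [ha, add_sub_cancel_right]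
    -- the reversed seam term is absent
    have hS' : ¬ (a' = 0 ∧ (a = -1 ∧ b = b')) := by
      rintro ⟨h0, hm, -⟩
      apply two_ne_zero_zmod L hL
      have h11 : (1 : ZMod L) = -1 := by rw [← hm, ha, h0, zero_add]
      linear_combination h11
    rw [if_neg hS', add_zero]
    by_cases hs : a = 0
    · -- seam bond
      have hm1 : a' = -1 := by rw [ha', hs, zero_sub]
      rw [if_pos (show a = 0 ∧ (a' = -1 ∧ b' = b) from ⟨hs, hm1, hb.symm⟩), hfac, ← Complex.exp_add,
        if_pos hs, ← ha']
      congr 2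
      push_cast
      ring
    · -- ordinary bond
      have hS : ¬ (a = 0 ∧ (a' = -1 ∧ b' = b)) := fun h => hs h.1
      rw [if_neg hS, add_zero, if_neg hs, ← ha']
      congr 2
      push_cast
      ring
  · by_cases h2 : a' = a + 1 ∧ b = b'
    · -- `y = x + e₁`
      obtain ⟨ha, hb⟩ := h2
      have hadj : (¬(a = a' ∧ b = b') ∧ ((a' = a + 1 ∧ b' = b ∨ a' = a ∧ b' = b + 1) ∨
          (a = a' + 1 ∧ b = b' ∨ a = a' ∧ b = b' + 1))) := by
        refine ⟨fun h => ?_, Or.inl (Or.inl ⟨ha, hb.symm⟩)⟩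
        have h0 : (1 : ZMod L) = 0 := by linear_combination ha.symm.trans h.1.symm
        exact one_ne_zero h0
      rw [if_pos hadj, if_pos hadj, if_neg h1, if_pos (show a' = a + 1 ∧ b = b' from ⟨ha, hb⟩)]
      have ha' : a = a' - 1 := by rw [ha, add_sub_cancel_right]
      have hS : ¬ (a = 0 ∧ (a' = -1 ∧ b' = b)) := by
        rintro ⟨h0, hm, -⟩
        apply two_ne_zero_zmod L hL
        have h11 : (1 : ZMod L) = -1 := by rw [← hm, ha, h0, zero_add]
        linear_combination h11
      rw [if_neg hS, add_zero]
      by_cases hs : a' = 0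
      · -- seam bond, reversed orientation
        have hm1 : a = -1 := by rw [ha', hs, zero_sub]
        rw [if_pos (show a' = 0 ∧ (a = -1 ∧ b = b') from ⟨hs, hm1, hb⟩), hfac, ← Complex.exp_add,
          if_pos hs, ← ha']
        congr 2
        push_cast
        ring
      · have hS' : ¬ (a' = 0 ∧ (a = -1 ∧ b = b')) := fun h => hs h.1
        rw [if_neg hS', add_zero, if_neg hs, ← ha']
        congr 2
        push_cast
        ring
    · -- no longitudinal step: transverse bond or no bond; no seam term
      have hS : ¬ (a = 0 ∧ (a' = -1 ∧ b' = b)) := by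
        rintro ⟨h0, hm, hb⟩
        exact h1 ⟨by rw [h0, hm, neg_add_cancel], hb.symm⟩
      have hS' : ¬ (a' = 0 ∧ (a = -1 ∧ b = b')) := by
        rintro ⟨h0, hm, hb⟩
        exact h2 ⟨by rw [h0, hm, neg_add_cancel], hb⟩
      rw [if_neg hS, if_neg hS', add_zero, add_zero, if_neg h1, if_neg h2]
      by_cases hadj : (¬(a = a' ∧ b = b') ∧ ((a' = a + 1 ∧ b' = b ∨ a' = a ∧ b' = b + 1) ∨
          (a = a' + 1 ∧ b = b' ∨ a = a' ∧ b = b' + 1)))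
      · rw [if_pos hadj, if_pos hadj]
        -- transverse: `a = a'`
        have haa : a = a' := by
          rcases hadj.2 with (h | h) | (h | h)
          · exact absurd ⟨h.1, h.2.symm⟩ h2
          · exact h.1.symm
          · exact absurd h h1
          · exact h.1
        rw [haa, sub_self, Complex.ofReal_zero, zero_mul, Complex.exp_zero]
      · rw [if_neg hadj, if_neg hadj, neg_zero]

/-- **The profile-gauged, seam-twisted tube in expectation** (`L ≥ 3`): for `g_z = e^{iΦ(z₁)}`,
`⟨ψ, W_g (H₀ + Tw_θ) W_gᴴ ψ⟩ = -Σ_{x∼y,σ} ω_{Φ,θ}(x,y) ⟨ψ, c†_{xσ}c_{yσ} ψ⟩ + U⟨ψ, Σ n↑n↓ ψ⟩` with the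
Peierls weights `e^{iφ(x₁)}` / `e^{-iφ(y₁)}` on the two orientations of the longitudinal bonds and `1`
on the transverse ones. [cite: KomaTasakiPRL1992, eqs. (7)–(8)] -/
theorem expect_profileGauged_tubeH (hL : 3 ≤ L) (Φ : ZMod L → ℝ) (U θ : ℝ) (ψ : Fock (Orb Λ)) :
    expect (phaseGauge (fun z : Λ => Circle.exp (Φ (e z).1)) *
        (tubeH0 L M Λ e U + tubeTwist L M Λ e θ) *
        (phaseGauge (fun z : Λ => Circle.exp (Φ (e z).1)))ᴴ) ψ =
      -(∑ x : Λ, ∑ y : Λ, ∑ σ : Fin 2, if (tubeGraph e).Adj x y then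
          (if (e x).1 = (e y).1 + 1 ∧ (e x).2 = (e y).2 then
              Complex.exp (((Φ (e x).1 - Φ ((e x).1 - 1) + if (e x).1 = 0 then θ else 0 : ℝ) : ℂ) * Complex.I)
            else if (e y).1 = (e x).1 + 1 ∧ (e x).2 = (e y).2 then
              Complex.exp (-((((Φ (e y).1 - Φ ((e y).1 - 1) + if (e y).1 = 0 then θ else 0 : ℝ) : ℂ)) * Complex.I))
            else 1) * expect (creation (orb x σ) * annihilation (orb y σ)) ψ
          else 0) +
        (U : ℂ) * expect (∑ x : Λ, numberOp x 0 * numberOp x 1) ψ := by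
  rw [Matrix.mul_add, Matrix.add_mul, expect_add, tubeH0_eq, expect_phaseGauge_conj_hamiltonian,
    expect_phaseGauge_conj_tubeTwist]
  simp only [Finset.sum_add_distrib]
  -- the two seam sums as double sums over ordered pairs
  rw [sum_seam_eq_sum_sum L M Λ e (fun x y => ∑ σ : Fin 2, (1 - Complex.exp (Complex.I * θ)) *
      (((Circle.exp (Φ (e x).1) : ℂ) * conj (Circle.exp (Φ (e y).1) : ℂ)) *
        expect (creation (orb x σ) * annihilation (orb y σ)) ψ)),
    sum_seam_eq_sum_sum' L M Λ e (fun x y => ∑ σ : Fin 2, (1 - Complex.exp (-(Complex.I * θ))) *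
      (((Circle.exp (Φ (e x).1) : ℂ) * conj (Circle.exp (Φ (e y).1) : ℂ)) *
        expect (creation (orb x σ) * annihilation (orb y σ)) ψ))]
  simp only [ite_sum_fin_two]
  -- everything under one triple sum
  rw [Complex.ofReal_one, neg_one_mul, add_assoc, add_comm ((U : ℂ) * _), ← add_assoc, ← add_assoc,
    add_left_inj]
  simp only [← Finset.sum_neg_distrib, ← Finset.sum_add_distrib]
  refine Finset.sum_congr rfl fun x _ => Finset.sum_congr rfl fun y _ => Finset.sum_congr rfl fun σ _ => ?_
  have key := profile_pointwise L M Λ e hL Φ θ x y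
  split_ifs at key ⊢ <;>
    linear_combination (expect (creation (orb x σ) * annihilation (orb y σ)) ψ) * key

/-- **The variational price of a profile, real part** (`L ≥ 3`):
`Re⟨ψ, W_g (H₀ + Tw_θ) W_gᴴ ψ⟩ = Re⟨ψ, H₀ ψ⟩ + Σ_{x∼y,σ} Re[(1 - ω_{Φ,θ}(x,y)) ⟨ψ, c†_{xσ}c_{yσ} ψ⟩]`.
[cite: KomaTasakiPRL1992, eqs. (7)–(8)] -/
theorem re_expect_profileGauged_tubeH (hL : 3 ≤ L) (Φ : ZMod L → ℝ) (U θ : ℝ) (ψ : Fock (Orb Λ)) :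
    (expect (phaseGauge (fun z : Λ => Circle.exp (Φ (e z).1)) *
        (tubeH0 L M Λ e U + tubeTwist L M Λ e θ) *
        (phaseGauge (fun z : Λ => Circle.exp (Φ (e z).1)))ᴴ) ψ).re =
      (expect (tubeH0 L M Λ e U) ψ).re +
        ∑ x : Λ, ∑ y : Λ, ∑ σ : Fin 2, if (tubeGraph e).Adj x y then
          ((1 - (if (e x).1 = (e y).1 + 1 ∧ (e x).2 = (e y).2 then
              Complex.exp (((Φ (e x).1 - Φ ((e x).1 - 1) + if (e x).1 = 0 then θ else 0 : ℝ) : ℂ) * Complex.I)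
            else if (e y).1 = (e x).1 + 1 ∧ (e x).2 = (e y).2 then
              Complex.exp (-((((Φ (e y).1 - Φ ((e y).1 - 1) + if (e y).1 = 0 then θ else 0 : ℝ) : ℂ)) * Complex.I))
            else 1)) * expect (creation (orb x σ) * annihilation (orb y σ)) ψ).re
          else 0 := by
  rw [expect_profileGauged_tubeH L M Λ e hL Φ U θ ψ, tubeH0_eq, expect_hamiltonian_eq, Complex.ofReal_one,
    neg_one_mul, Complex.add_re, Complex.add_re, Complex.neg_re, Complex.neg_re, Complex.re_sum,
    Complex.re_sum]
  rw [show ∀ (A B C : ℝ), -A + C = -B + C + (B - A) from fun A B C => by ring, add_right_inj,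
    ← Finset.sum_sub_distrib]
  refine Finset.sum_congr rfl fun x _ => ?_
  rw [Complex.re_sum, Complex.re_sum, ← Finset.sum_sub_distrib]
  refine Finset.sum_congr rfl fun y _ => ?_
  rw [Complex.re_sum, Complex.re_sum, ← Finset.sum_sub_distrib]
  refine Finset.sum_congr rfl fun σ _ => ?_
  by_cases hadj : (tubeGraph e).Adj x y
  · rw [if_pos hadj, if_pos hadj, if_pos hadj, ← Complex.sub_re]
    congr 1
    ring
  · rw [if_neg hadj, if_neg hadj, if_neg hadj, sub_self]

end Profile

/-- **The price of a profile, closed form** (all binders universally quantified; the registered sub-goal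
`profileGaugePrice` of crux stmt-HubbardSuperconductivity-16311): the real part of the expectation of
the profile-gauged twisted tube in any vector is `Re⟨ψ, H₀ψ⟩` plus the Peierls-weighted longitudinal
amplitudes. [cite: KomaTasakiPRL1992, eqs. (7)–(8)] -/
theorem profileGaugePrice : ∀ (L M : ℕ) [NeZero L] [NeZero M] (Λ : Type) [LinearOrder Λ] [Fintype Λ] (e : Λ ≃ ZMod L × ZMod M), 3 ≤ L → ∀ (Φ : ZMod L → ℝ) (U θ : ℝ) (ψ : Fock (Orb Λ)), (expect (phaseGauge (fun z : Λ => Circle.exp (Φ (e z).1)) * (tubeH0 L M Λ e U + tubeTwist L M Λ e θ) * (phaseGauge (fun z : Λ => Circle.exp (Φ (e z).1)))ᴴ) ψ).re = (expect (tubeH0 L M Λ e U) ψ).re + ∑ x : Λ, ∑ y : Λ, ∑ σ : Fin 2, if (tubeGraph e).Adj x y then ((1 - (if (e x).1 = (e y).1 + 1 ∧ (e x).2 = (e y).2 then Complex.exp (((Φ (e x).1 - Φ ((e x).1 - 1) + if (e x).1 = 0 then θ else 0 : ℝ) : ℂ) * Complex.I) else if (e y).1 = (e x).1 + 1 ∧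 (e x).2 = (e y).2 then Complex.exp (-((((Φ (e y).1 - Φ ((e y).1 - 1) + if (e y).1 = 0 then θ else 0 : ℝ) : ℂ)) * Complex.I)) else 1)) * expect (creation (orb x σ) * annihilation (orb y σ)) ψ).re else 0 :=
  fun L M _ _ Λ _ _ e hL Φ U θ ψ => re_expect_profileGauged_tubeH L M Λ e hL Φ U θ ψ

end Summit.HubbardSuperconductivity.HubbardSuperconductivity.Theorems.WidthHaldane

end
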